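import Summits.ValiantsHypothesis.ValiantsHypothesis.Theorems.DepthWindowFirstJump
import Mathlib.Data.Matrix.Mul
import HarnessLib

/-!
# Route `DepthWindow`, g8 — the jump-indexed branching program of a truncated product (sparse ABP)

Kernel piece (i′) of the SPARSE form of the `(2,3)` sliver lemma (lens-4 NODE-v8 §8), on top of
`Theorems/DepthWindowFirstJump.lean`.  For factors `U_0, …, U_{t-1}`, a weight cap `d` and a
target weight `e ≤ d`:

* `jumpMat` — the `(d+1)(t+1)`-state jump matrix: `(ω, m) → (ω', m')` (`m < m'`, `ω < ω'`) passes
  `U_m … U_{m'-2}` at weight `0` and takes the component `[U_{m'-1}]_{ω'-ω}`; `finVec` — pass all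
  remaining factors at weight `0` once the weight is `e`; `pathVec K = ∑_{k ≤ K} jumpMat^k · finVec`
  (`pathVec_eq_sum_pow`).
* `weightedHomogeneousComponent_prod_Ico_eq_pathVec` — from every state, the `≤ K`-jump path sum
  IS the weight-`(e-ω)` component of the product of the remaining factors (`K ≥ e - ω`); in
  particular `[∏_{l<t} U_l]_e = pathVec e (0,0)` (`weightedHomogeneousComponent_prod_eq_pathVec`)
  and the IMM form `weightedHomogeneousComponent_prod_eq_sum_imm`:
  `[∏_{l<t} U_l]_e = ∑_{k ≤ e} ∑_y (jumpMat^{×k})_{(0,0),y} · finVec y`.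

So the weight-`e` component of a product gate of fan-in `t` is the value of a layered program with
`≤ e ≤ d` layers over `(d+1)(t+1)` states whose edge labels are (weight-`0` scalars times) single
components `[U_j]_ρ` — the time axis is the NUMBER OF POSITIVE-WEIGHT FACTORS, not the position.
`imm_apply_eq_sum_paths_blocks` (`Theorems/DepthWindowIMMPaths.lean`) regroups `jumpMat^{×ab}`
into `a` blocks of `b` layers: with `a = b = ⌈√e⌉` this is the `Σ Π^{[√d]} Σ Π^{[√d]}` form of
size `((d+1)(t+1))^{O(√d)}`, homogeneous layer by layer — the sliver regime `t ≤ 2^{O(d^{1.5})}`.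
What remains for the sliver lemma is gate-level (realise the blocks as gates; merge the inner `Π`
with the product layer of the level below).  Pure algebra; nothing here bears on `VP ≠ VNP`.

[cite: LimayeSrinivasanTavenas2025, Lemma 11] [cite: Burgisser2000, Def. 2.1]
-/

set_option linter.dupNamespace false

namespace Summit.ValiantsHypothesis.ValiantsHypothesis.Theorems.DepthWindow

open MvPolynomial Finset

/-! ### The jump-indexed branching program: states (weight so far, factors consumed) -/

section JumpPaths

variable {σ R : Type*} [CommSemiring R]

/-- The jump matrix on states `(ω, m) ∈ Fin (d+1) × Fin (t+1)` (`ω` = weight accumulated so far,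
`m` = number of factors already passed): the transition `(ω, m) → (ω', m')` with `m < m'`, `ω < ω'`
passes the factors `U_m, …, U_{m'-2}` at weight `0` and takes weight `ω' - ω` from `U_{m'-1}`;
all other entries are `0`. -/
noncomputable def jumpMat (w : σ → ℕ) (d t : ℕ) (U : ℕ → MvPolynomial σ R) :
    Matrix (Fin (d + 1) × Fin (t + 1)) (Fin (d + 1) × Fin (t + 1)) (MvPolynomial σ R) :=
  Matrix.of fun x y =>
    if (x.2 : ℕ) < y.2 ∧ (x.1 : ℕ) < y.1 then
      (∏ l ∈ Ico (x.2 : ℕ) ((y.2 : ℕ) - 1), weightedHomogeneousComponent w 0 (U l)) *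
        weightedHomogeneousComponent w ((y.1 : ℕ) - x.1) (U ((y.2 : ℕ) - 1))
    else 0

/-- The terminal vector for target weight `e`: from state `(ω, m)` with `ω = e`, pass all remaining
factors at weight `0`. -/
noncomputable def finVec (w : σ → ℕ) (d t e : ℕ) (U : ℕ → MvPolynomial σ R) :
    Fin (d + 1) × Fin (t + 1) → MvPolynomial σ R :=
  fun x => if (x.1 : ℕ) = e then ∏ l ∈ Ico (x.2 : ℕ) t, weightedHomogeneousComponent w 0 (U l) else 0

/-- The `≤ K`-jump path sum from a state: `pathVec K = ∑_{k ≤ K} jumpMat^k · finVec`, defined by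
the recursion `pathVec (K+1) = finVec + jumpMat · pathVec K`. -/
noncomputable def pathVec (w : σ → ℕ) (d t e : ℕ) (U : ℕ → MvPolynomial σ R) :
    ℕ → Fin (d + 1) × Fin (t + 1) → MvPolynomial σ R
  | 0 => finVec w d t e U
  | K + 1 => fun x => finVec w d t e U x + ∑ y, jumpMat w d t U x y * pathVec w d t e U K y

/-- Entries of the jump matrix (definitional unfolding). -/
theorem jumpMat_apply (w : σ → ℕ) (d t : ℕ) (U : ℕ → MvPolynomial σ R)
    (x y : Fin (d + 1) × Fin (t + 1)) :
    jumpMat w d t U x y =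
      if (x.2 : ℕ) < y.2 ∧ (x.1 : ℕ) < y.1 then
        (∏ l ∈ Ico (x.2 : ℕ) ((y.2 : ℕ) - 1), weightedHomogeneousComponent w 0 (U l)) *
          weightedHomogeneousComponent w ((y.1 : ℕ) - x.1) (U ((y.2 : ℕ) - 1))
      else 0 := rfl

/-- `pathVec 0 = finVec`. -/
theorem pathVec_zero (w : σ → ℕ) (d t e : ℕ) (U : ℕ → MvPolynomial σ R) :
    pathVec w d t e U 0 = finVec w d t e U := rfl

/-- The defining recursion `pathVec (K+1) = finVec + jumpMat · pathVec K`, entrywise. -/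
theorem pathVec_succ (w : σ → ℕ) (d t e : ℕ) (U : ℕ → MvPolynomial σ R) (K : ℕ)
    (x : Fin (d + 1) × Fin (t + 1)) :
    pathVec w d t e U (K + 1) x =
      finVec w d t e U x + ∑ y, jumpMat w d t U x y * pathVec w d t e U K y := rfl

/-- Extension of a state function by `0` outside the state box (to write recursions over `ℕ`). -/
noncomputable def extN {d t : ℕ} (G : Fin (d + 1) × Fin (t + 1) → MvPolynomial σ R) (a b : ℕ) :
    MvPolynomial σ R :=
  if h : a < d + 1 ∧ b < t + 1 then G (⟨a, h.1⟩, ⟨b, h.2⟩) else 0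

/-- `extN` agrees with the function inside the state box. -/
theorem extN_of_lt {d t : ℕ} (G : Fin (d + 1) × Fin (t + 1) → MvPolynomial σ R) {a b : ℕ}
    (ha : a < d + 1) (hb : b < t + 1) : extN G a b = G (⟨a, ha⟩, ⟨b, hb⟩) := by
  unfold extN; rw [dif_pos ⟨ha, hb⟩]

/-- **One layer of the jump program, as a sum over (first jump position `j`, its weight `i+1`).** -/
theorem jumpMat_mulVec_eq (w : σ → ℕ) (d t : ℕ) (U : ℕ → MvPolynomial σ R)
    (G : Fin (d + 1) × Fin (t + 1) → MvPolynomial σ R) (ω : Fin (d + 1)) (m : Fin (t + 1)) :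
    ∑ y, jumpMat w d t U (ω, m) y * G y =
      ∑ j ∈ Ico (m : ℕ) t, (∏ l ∈ Ico (m : ℕ) j, weightedHomogeneousComponent w 0 (U l)) *
        ∑ i ∈ range (d - ω), weightedHomogeneousComponent w (i + 1) (U j) *
          extN G ((ω : ℕ) + i + 1) (j + 1) := by
  -- the summand as a function of the ℕ-coordinates of `y`
  set Φ : ℕ → ℕ → MvPolynomial σ R := fun a b =>
    (if (m : ℕ) < b ∧ (ω : ℕ) < a then
      (∏ l ∈ Ico (m : ℕ) (b - 1), weightedHomogeneousComponent w 0 (U l)) *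
        weightedHomogeneousComponent w (a - ω) (U (b - 1))
      else 0) * extN G a b with hΦ
  have h1 : ∑ y, jumpMat w d t U (ω, m) y * G y = ∑ b ∈ range (t + 1), ∑ a ∈ range (d + 1), Φ a b := by
    rw [Fintype.sum_prod_type, Finset.sum_comm]
    rw [← Fin.sum_univ_eq_sum_range (fun b => ∑ a ∈ range (d + 1), Φ a b) (t + 1)]
    refine Finset.sum_congr rfl fun b _ => ?_
    rw [← Fin.sum_univ_eq_sum_range (fun a => Φ a b) (d + 1)]
    refine Finset.sum_congr rfl fun a _ => ?_
    simp only [hΦ]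
    rw [jumpMat_apply, extN_of_lt G a.isLt b.isLt]
  rw [h1, Finset.sum_range_succ', ← Finset.sum_range_add_sum_Ico _ (show (m : ℕ) ≤ t by omega)]
  -- b = 0 and b - 1 < m contribute nothing
  have hb0 : ∑ a ∈ range (d + 1), Φ a 0 = 0 := by
    refine Finset.sum_eq_zero fun a _ => ?_
    simp only [hΦ]
    rw [if_neg (fun h => Nat.not_lt_zero _ h.1), zero_mul]
  have hblow : ∑ j ∈ range (m : ℕ), ∑ a ∈ range (d + 1), Φ a (j + 1) = 0 := by
    refine Finset.sum_eq_zero fun j hj => Finset.sum_eq_zero fun a _ => ?_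
    rw [Finset.mem_range] at hj
    simp only [hΦ]
    rw [if_neg (fun h => by omega), zero_mul]
  rw [hb0, add_zero, hblow, zero_add]
  refine Finset.sum_congr rfl fun j hj => ?_
  rw [Finset.mem_Ico] at hj
  -- the `a`-sum: a = ω + i + 1
  rw [Finset.sum_range_succ', ← Finset.sum_range_add_sum_Ico _ (show (ω : ℕ) ≤ d by omega),
    Finset.sum_Ico_eq_sum_range]
  have ha0 : Φ 0 (j + 1) = 0 := by
    simp only [hΦ]
    rw [if_neg (fun h => Nat.not_lt_zero _ h.2), zero_mul]
  have halow : ∑ a ∈ range (ω : ℕ), Φ (a + 1) (j + 1) = 0 := by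
    refine Finset.sum_eq_zero fun a ha => ?_
    rw [Finset.mem_range] at ha
    simp only [hΦ]
    rw [if_neg (fun h => by omega), zero_mul]
  rw [ha0, add_zero, halow, zero_add, Finset.mul_sum]
  refine Finset.sum_congr rfl fun i _ => ?_
  simp only [hΦ]
  rw [if_pos ⟨by omega, by omega⟩, Nat.add_sub_cancel,
    show (ω : ℕ) + i + 1 - ω = i + 1 by omega]
  ring

/-- States of weight beyond the target contribute nothing. -/
theorem pathVec_eq_zero_of_lt (w : σ → ℕ) (d t e : ℕ) (U : ℕ → MvPolynomial σ R) :
    ∀ (K : ℕ) (y : Fin (d + 1) × Fin (t + 1)), e < (y.1 : ℕ) → pathVec w d t e U K y = 0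
  | 0, y, hy => by
      rw [pathVec_zero]; unfold finVec; rw [if_neg (by omega)]
  | K + 1, y, hy => by
      rw [pathVec_succ]
      unfold finVec; rw [if_neg (by omega), zero_add]
      refine Finset.sum_eq_zero fun z _ => ?_
      by_cases hz : (y.2 : ℕ) < z.2 ∧ (y.1 : ℕ) < z.1
      · rw [pathVec_eq_zero_of_lt w d t e U K z (lt_trans hy hz.2), mul_zero]
      · rw [jumpMat_apply, if_neg hz, zero_mul]

/-- **The sparse (jump-indexed) path-sum formula.**  From any state `(ω, m)` with `ω ≤ e ≤ d` and
`K ≥ e - ω` jumps allowed, the `≤ K`-jump path sum equals the weight-`(e - ω)` component of the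
product of the remaining factors `U_m ⋯ U_{t-1}`. -/
theorem weightedHomogeneousComponent_prod_Ico_eq_pathVec (w : σ → ℕ) (d t e : ℕ) (he : e ≤ d)
    (U : ℕ → MvPolynomial σ R) :
    ∀ (K : ℕ) (x : Fin (d + 1) × Fin (t + 1)), (x.1 : ℕ) ≤ e → e - x.1 ≤ K →
      weightedHomogeneousComponent w (e - x.1) (∏ l ∈ Ico (x.2 : ℕ) t, U l) =
        pathVec w d t e U K x
  | 0, ⟨ω, m⟩, hx, hK => by
      have hω : (ω : ℕ) = e := by dsimp only at hx hK; omega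
      show weightedHomogeneousComponent w (e - ω) (∏ l ∈ Ico (m : ℕ) t, U l) = _
      rw [pathVec_zero, hω, Nat.sub_self]
      unfold finVec
      rw [if_pos hω]
      have h := weightedHomogeneousComponent_prod_Ico_firstJump w U (t - m) m 0
      rw [show (m : ℕ) + (t - m) = t by omega] at h
      rw [h, if_pos rfl]
      simp only [Finset.range_zero, Finset.sum_empty, mul_zero, Finset.sum_const_zero, add_zero]
  | K + 1, ⟨ω, m⟩, hx, hK => by
      dsimp only at hx hK
      show weightedHomogeneousComponent w (e - ω) (∏ l ∈ Ico (m : ℕ) t, U l) = _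
      rw [pathVec_succ, jumpMat_mulVec_eq]
      have h := weightedHomogeneousComponent_prod_Ico_firstJump w U (t - m) m (e - ω)
      rw [show (m : ℕ) + (t - m) = t by omega] at h
      rw [h]
      congr 1
      · unfold finVec
        by_cases hω : (ω : ℕ) = e
        · rw [if_pos (by omega), if_pos hω]
        · rw [if_neg (by omega), if_neg hω]
      · refine Finset.sum_congr rfl fun j hj => ?_
        rw [Finset.mem_Ico] at hj
        congr 1
        rw [← Finset.sum_range_add_sum_Ico _ (show e - (ω : ℕ) ≤ d - ω by omega)]
        have hhigh : ∑ i ∈ Ico (e - (ω : ℕ)) (d - ω),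
            weightedHomogeneousComponent w (i + 1) (U j) *
              extN (pathVec w d t e U K) ((ω : ℕ) + i + 1) (j + 1) = 0 := by
          refine Finset.sum_eq_zero fun i hi => ?_
          rw [Finset.mem_Ico] at hi
          have hlt : e < (ω : ℕ) + i + 1 := by omega
          rw [extN_of_lt _ (show (ω : ℕ) + i + 1 < d + 1 by omega) (show j + 1 < t + 1 by omega),
            pathVec_eq_zero_of_lt w d t e U K _ hlt, mul_zero]
        rw [hhigh, add_zero]
        refine Finset.sum_congr rfl fun i hi => ?_
        rw [Finset.mem_range] at hi
        have hle : (ω : ℕ) + i + 1 ≤ e := by omega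
        have hK' : e - ((ω : ℕ) + i + 1) ≤ K := by omega
        rw [extN_of_lt _ (show (ω : ℕ) + i + 1 < d + 1 by omega) (show j + 1 < t + 1 by omega),
          ← weightedHomogeneousComponent_prod_Ico_eq_pathVec w d t e he U K
            (⟨(ω : ℕ) + i + 1, by omega⟩, ⟨j + 1, by omega⟩) hle hK']
        show _ = weightedHomogeneousComponent w (i + 1) (U j) *
          weightedHomogeneousComponent w (e - ((ω : ℕ) + i + 1)) (∏ l ∈ Ico (j + 1) t, U l)
        rw [show e - (ω : ℕ) - (i + 1) = e - ((ω : ℕ) + i + 1) by omega]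

/-- **Corollary (the form used by the sliver lemma).**  For `e ≤ d` and any `K ≥ e`:
`[∏_{l<t} U_l]_e = pathVec K (0, 0) = ∑_{k ≤ K} (jumpMat^k · finVec)(0,0)` — the weight-`e`
component of a product of fan-in `t` is the value of a layered branching program with `≤ e + 1`
layers of `(d+1)(t+1)` states whose edge labels are scalars times single components `[U_j]_ρ`;
`Theorems/DepthWindowIMMPaths.lean` then regroups each `jumpMat^k` into `√k` blocks. -/
theorem weightedHomogeneousComponent_prod_eq_pathVec (w : σ → ℕ) (d t e K : ℕ) (he : e ≤ d)
    (hK : e ≤ K) (U : ℕ → MvPolynomial σ R) :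
    weightedHomogeneousComponent w e (∏ l ∈ range t, U l) =
      pathVec w d t e U K ((0 : Fin (d + 1)), (0 : Fin (t + 1))) := by
  have h := weightedHomogeneousComponent_prod_Ico_eq_pathVec w d t e he U K ((0 : Fin (d + 1)), 0)
    (Nat.zero_le _) (by show e - 0 ≤ K; omega)
  rw [Finset.range_eq_Ico]
  exact h

end JumpPaths

/-! ### Matrix-power form: the interface to `Theorems/DepthWindowIMMPaths.lean` -/

section PowForm

variable {σ R : Type*} [CommSemiring R]

/-- `pathVec K = ∑_{k ≤ K} jumpMat^k · finVec`. -/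
theorem pathVec_eq_sum_pow (w : σ → ℕ) (d t e : ℕ) (U : ℕ → MvPolynomial σ R) :
    ∀ (K : ℕ) (x : Fin (d + 1) × Fin (t + 1)),
      pathVec w d t e U K x =
        ∑ k ∈ range (K + 1), ((jumpMat w d t U ^ k).mulVec (finVec w d t e U)) x
  | 0, x => by
      rw [pathVec_zero, Finset.sum_range_one, pow_zero, Matrix.one_mulVec]
  | K + 1, x => by
      rw [pathVec_succ, Finset.sum_range_succ' _ (K + 1), pow_zero, Matrix.one_mulVec, add_comm]
      congr 1
      have ih : ∀ y, pathVec w d t e U K y =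
          ∑ k ∈ range (K + 1), ((jumpMat w d t U ^ k).mulVec (finVec w d t e U)) y :=
        fun y => pathVec_eq_sum_pow w d t e U K y
      simp_rw [ih, Finset.mul_sum]
      rw [Finset.sum_comm]
      refine Finset.sum_congr rfl fun k _ => ?_
      rw [pow_succ', ← Matrix.mulVec_mulVec]
      rfl

/-- **IMM form of the sparse expansion.**  For `e ≤ d`:
`[∏_{l<t} U_l]_e = ∑_{k ≤ e} ∑_y (jumpMat^{×k})_{(0,0), y} · finVec y`, each inner term an entry of
an iterated product of `k` copies of the `(d+1)(t+1)`-state jump matrix — exactly the shape that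
`imm_apply_eq_sum_paths_blocks` (with `a·b` layers, padding by `k ≤ a·b` identity-free since all
layers are equal) regroups into `√k` blocks of `√k` layers. -/
theorem weightedHomogeneousComponent_prod_eq_sum_imm (w : σ → ℕ) (d t e : ℕ) (he : e ≤ d)
    (U : ℕ → MvPolynomial σ R) :
    weightedHomogeneousComponent w e (∏ l ∈ range t, U l) =
      ∑ k ∈ range (e + 1), ∑ y : Fin (d + 1) × Fin (t + 1),
        (List.ofFn fun _ : Fin k => jumpMat w d t U).prod ((0 : Fin (d + 1)), (0 : Fin (t + 1))) y *
          finVec w d t e U y := by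
  rw [weightedHomogeneousComponent_prod_eq_pathVec w d t e e he le_rfl U, pathVec_eq_sum_pow]
  refine Finset.sum_congr rfl fun k _ => ?_
  rw [List.ofFn_const, List.prod_replicate]
  rfl

end PowForm

end Summit.ValiantsHypothesis.ValiantsHypothesis.Theorems.DepthWindow
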